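import Literature.NumberTheory.EllipticCurves.Kato2004.DefinedExpStarBodyScalingProofs
import Literature.NumberTheory.EllipticCurves.Kato2004.EulerSystemIsogenyTransportZeta
import Literature.NumberTheory.EllipticCurves.Kato2004.ExpStarCoordIsogenyProofs
import Literature.NumberTheory.PAdicHodge.DualExpTransportEquiv
import HarnessLib

/-!
# Kato's matrix with the dual exponential DEFINED (`Kato2004.DefinedExpStarBody`) is TRANSPORTED along a `ℚ`-isogeny pair
# `β : W → W₂`, `α : W₂ → W`, `α ∘ β = [e]`: `(d, Λ, z) ↦ (e • (V_pα)⁻¹d, e⁻¹ • Λ ∘ α_*, β_* z)` — hypothesis-free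

`Proofs`-style companion of `EulerSystemDefinedValues.lean` / `EulerSystemIsogenyTransportZeta.lean` (THEOREMS ONLY: no definition, no
named fact, no instance, no notation, no `sorry`).  Seat `bsd-cm-k-ty1` g35 (literature-prover, cell `bsd-cm`), row (T5-nat) of the
`𝒞₇` genus road (crux `EllipticUnitValueSevenOfGZK` = stmt-BirchSwinnertonDyer-19945, K7r; pen bsd-cm-plan g39 D1138/D1139/D1141, critic
idea-crit-15 g18 NOTE #21 (C)): the (A1)-half `DefinedExpStarBody` of the realised-family binders of F-P1
(`CM.kato15161_ellipticUnitClass_res_zetaFamily`) moves from a member `W` to its prime-to-`p` isogenous partner `W₂` WITHOUT any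
`p`-adic Hodge input, because exp* along a linear EQUIVALENCE of representations is hypothesis-free (`dualExpCoord_map_equiv`, p823921).

## What is proved

* §1 `rationalTateModuleEquiv_symm_restrict` — the inverse `(V_pφ)⁻¹ : V_pW′ ≃ V_pW` of the rational Tate-module isomorphism of an isogeny
  `φ : W → W′` (`rationalTateModuleMap_bijective`) intertwines the rational Tate representations restricted along ANY continuous
  `g : Γ′ → Γ_{K₀}` (level `ℚ_v` and every semi-local tower level at once); `expStarCoord_map_symm` — ★ for cocycles `η` of `T_pW′|_{Γ_F}`,
  `η′ = T_pφ ∘ η` of `T_pW|_{Γ_F}` and any generator `d` of `D⁰_dR(V_pW|_{Γ_F})`: `exp*_{(V_pφ)⁻¹ d}(η) = exp*_d(η′)` — NO `CupLogInjective` /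
  `HasDualExp` (compare `expStarCoord_eq_mul_of_tensorMap_eq_smul`, which carries both).
* §2 ★★ `definedExpStarBody_isogeny_transport` — for elliptic `W, W₂/ℚ`, a `ℚ`-isogeny pair `β : W → W₂`, `α : W₂ → W` with `α ∘ β = [e]`,
  `e ≠ 0`, and `DefinedExpStarBody W p f d ι κK Λ`: there is a generator `d₂` of `D⁰_dR(V_pW₂|_{Γ_{ℚ_v}})` — namely `e • (V_pα)⁻¹ d`, `e` read in
  `ℚ_v` through Mathlib's `Padic.adicCompletionEquiv` — with (i) `exp*_{d₂}(η) = e⁻¹ · exp*_d(η′)` for all cocycles `η` of `T_pW₂|_{Γ_{ℚ_v}}`,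
  `η′ = T_pα ∘ η` of `T_pW|_{Γ_{ℚ_v}}`, and (ii) `DefinedExpStarBody W₂ p f d₂ ι κK Λ₂` for the transported value maps
  `Λ₂ := fun k r ↦ (e : ℚ)⁻¹ • (Λ k r ∘ α_*)` — LETTER FOR LETTER the datum of `ZetaBody.isogeny_transport` (so that (A1) and (A3) at `W₂`
  speak of the same `Λ₂`).  (RES) at `W₂`: both sides are `e⁻¹ ·` the (RES) sides at `W` for the pushed cocycles `α_* η₀, α_* η` (tower generator
  `e • (V_pα)⁻¹ d_{w₀}`); (DEF) at `W₂`: `Ψ(e⁻¹ • Λ(α_* y))_w = e⁻¹ · Ψ(Λ(α_* y))_w` (`Ψ` is `ℚ`-linear), the class representative `α ∘ φ″` of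
  `g_w · α_* y` (`isogenyMapH1_conjMap`, `isogenyMapH1_oneCocycleClass`), the tower cocycle `α ∘ ψT`, and `σ_{w₀→w}(e⁻¹ · X) = e⁻¹ · σ(X)`;
  the `ZetaBody` half by `ZetaBody.isogeny_transport` with the witnesses `(β_* z, x)`.

HONEST FRAMING: kernel facts about the tree's own definitions; nothing about zeta values, Kato's theorems or BSD is proved; the fact
`exists_eulerSystem_definedExpStar_values` is NOT discharged; no summit statement is touched.  What this does NOT transport: the
Tate-duality / Néron NORMALISATION clause (A2) of `AdmissibleZetaClassBody` (`∀ a, (∃ η, exp*_d η = a) ↔ ∀ Q ∈ W(ℚ_p), ‖a · log_ω Q‖ ≤ 1`),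
whose right-hand side is the formal logarithm of `W₂`'s own minimal model — see the seat's STATUS finding of 2026-08-31.

## References
* K. Kato, Astérisque 295 (2004), §9.4 (p. 188), Thm. 9.7 (p. 189), (8.1.3) (p. 180), Ex. 13.3 (pp. 224–225). [Kato2004Asterisque]
* K. Kato, LNM 1553 (1993), Ch. II §1.2.4 and Ex. 1.3.5 (naturality of `exp*`). [Kato1993LNM1553]
* S. Bloch, K. Kato (1990), Def. 3.10 and Ex. 3.11 (p. 361). [BlochKato1990]
* J. W. S. Cassels, A. Fröhlich (1967), Ch. II §10 (10.2), Ch. VII §1.1. [CasselsFrohlichANT1967]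
* J. H. Silverman, *AEC* (2009), III.7.4, Thm. III.6.1 (a). [SilvermanAEC2009]
* Tree: `Kato2004/EulerSystemDefinedValues.lean` (`DefinedExpStarBody`), `Kato2004/DefinedExpStarBodyScalingProofs.lean`
  (`expStarCoord_smul_generator`, the (RES)/(DEF) manipulation pattern), `Kato2004/EulerSystemIsogenyTransportZeta.lean`
  (`ZetaBody.isogeny_transport`), `Kato2004/EulerSystemIsogenyTransport.lean` (`isogenyMapH1`, `_conjMap`, `_oneCocycleClass`,
  `continuous_tateModule_map`), `Kato2004/ExpStarCoordIsogenyProofs.lean` (`rationalTateModuleMap_bijective`),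
  `PAdicHodge/DualExpTransportEquiv.lean` (`FilZeroLine.dualExpCoord_map_equiv`), `PAdicHodge/NeronDeRhamDatum.lean` (`FilZeroLine.map/smul`).
-/

noncomputable section

open scoped BigOperators NumberField TensorProduct Pointwise
open Polynomial Field IsDedekindDomain NumberField CongruenceSubgroup ValuativeRel
open Literature.NumberTheory.GaloisRepresentations
open Literature.NumberTheory.GaloisRepresentations.PeriodRingData
open Literature.NumberTheory.GaloisRepresentations.IsNonarchimedeanLocalField
open Literature.NumberTheory.PAdicHodge
open Literature.NumberTheory.EllipticCurves Literature.NumberTheory.EllipticCurves.ModularForms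
open Literature.NumberTheory.AdelicBaseChange Literature.NumberTheory.Automorphic
open WeierstrassCurve (Isogeny)

namespace Literature.NumberTheory.EllipticCurves.Kato2004

open EulerSystemValues Rat.HeightOneSpectrum

/-! ## §1 `(V_pφ)⁻¹` intertwines every restriction; `exp*` along `(V_pφ)⁻¹ d` is `exp*` along `d` of the pushed cocycle -/

section Equiv

variable {K₀ : Type} [Field K₀] {W W' : WeierstrassCurve K₀} [W.IsElliptic] [W'.IsElliptic] (p : ℕ) [Fact p.Prime]

/-- **`(V_pφ)⁻¹` intertwines the rational Tate representations restricted along any continuous `g : Γ′ → Γ_{K₀}`**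
(`V_pφ` does — `Isogeny.baseChange_tateModule_map_rationalGaloisRepTate` — and an intertwining isomorphism intertwines backwards).
[cite: SilvermanAEC2009, III.7.4] -/
theorem rationalTateModuleEquiv_symm_restrict (hp0 : (p : K₀) ≠ 0) (φ : Isogeny W W')
    {Γ' : Type*} [Group Γ'] [TopologicalSpace Γ'] (g : Γ' →ₜ* absoluteGaloisGroup K₀) (σ : Γ')
    (m : W'.rationalTateModule p) :
    (LinearEquiv.ofBijective _ (rationalTateModuleMap_bijective p hp0 φ)).symm
        (((W'.rationalTateGaloisRep p (W'.continuous_rationalGaloisRepTate_holds p)).restrict g) σ m) =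
      ((W.rationalTateGaloisRep p (W.continuous_rationalGaloisRepTate_holds p)).restrict g) σ
        ((LinearEquiv.ofBijective _ (rationalTateModuleMap_bijective p hp0 φ)).symm m) := by
  set E := LinearEquiv.ofBijective _ (rationalTateModuleMap_bijective p hp0 φ) with hE
  apply E.injective
  rw [LinearEquiv.apply_symm_apply]
  have h := φ.baseChange_tateModule_map_rationalGaloisRepTate p (g σ) (E.symm m)
  have hE' : ∀ x, E x = RationalTateModule.map p φ.toAddMonoidHom x := fun _ => rfl
  rw [ContinuousRep.restrict_apply, ContinuousRep.restrict_apply, hE']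
  change _ = ((TateModule.map p φ.toAddMonoidHom).baseChange ℚ_[p]) (W.rationalGaloisRepTate p (g σ) (E.symm m))
  rw [h]
  change W'.rationalGaloisRepTate p (g σ) m = W'.rationalGaloisRepTate p (g σ) (E (E.symm m))
  rw [LinearEquiv.apply_symm_apply]

variable {F : Type} [Field F] [Algebra K₀ F] [ValuativeRel F] [TopologicalSpace F]
  [IsNonarchimedeanLocalField F] [CharZero F] [Fact (¬ IsUnit (p : integerC F))]
  [IsAdicComplete (Ideal.span {(p : integerC F)}) (integerC F)] (hp : valuation F p < 1) [Algebra ℚ_[p] F]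

/-- ★ **`exp*_{(V_pφ)⁻¹ d}(η) = exp*_d(T_pφ ∘ η)` — HYPOTHESIS-FREE.**  For an isogeny `φ : W′ → W` over `K₀ ⊆ F` (`p ≠ char K₀`), a generator
`d` of `D⁰_dR(V_pW|_{Γ_F})`, a cocycle `η` of `T_pW′|_{Γ_F}` and the cocycle `η′ = T_pφ ∘ η` of `T_pW|_{Γ_F}`: the scalar dual exponential of
`η` along the transported generator `(V_pφ)⁻¹ d` of `D⁰_dR(V_pW′|_{Γ_F})` equals that of `η′` along `d`
(`FilZeroLine.dualExpCoord_map_equiv` along `(V_pφ)⁻¹`; `(V_pφ)⁻¹ (V_pφ (1 ⊗ η σ)) = 1 ⊗ η σ`).  No `CupLogInjective`, no `HasDualExp`.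
[cite: Kato1993LNM1553, Ch. II §1.2.4 and Ex. 1.3.5] [cite: BlochKato1990, Def. 3.10 and Ex. 3.11 (p. 361)] -/
theorem expStarCoord_map_symm (hp0 : (p : K₀) ≠ 0) (φ : Isogeny W' W)
    (d : (bdRPeriodRingData (F := F) (p := p) hp).FilZeroLine (restrictedRationalTateRep W F p))
    (η : contOneCocycles (restrictedTateRep W' F p).toTopRep) (η' : contOneCocycles (restrictedTateRep W F p).toTopRep)
    (hη : ∀ σ, η'.1 σ = TateModule.map p φ.toAddMonoidHom (η.1 σ)) :
    expStarCoord W' hp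
        (d.map (LinearEquiv.ofBijective _ (rationalTateModuleMap_bijective p hp0 φ)).symm
          (rationalTateModuleEquiv_symm_restrict p hp0 φ (absGaloisRestrict K₀ F))) η =
      expStarCoord W hp d η' := by
  unfold expStarCoord
  have hfun : (fun σ => TateModule.toRational p (η.1 σ)) =
      fun σ => (LinearEquiv.ofBijective _ (rationalTateModuleMap_bijective p hp0 φ)).symm
        ((fun σ => TateModule.toRational p (η'.1 σ)) σ) := by
    funext σ
    show _ = (LinearEquiv.ofBijective _ (rationalTateModuleMap_bijective p hp0 φ)).symm (TateModule.toRational p (η'.1 σ))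
    rw [hη σ]
    exact ((LinearEquiv.ofBijective _ (rationalTateModuleMap_bijective p hp0 φ)).symm_apply_apply _).symm
  rw [hfun]
  exact FilZeroLine.dualExpCoord_map_equiv d _ _

end Equiv

/-! ## §2 ★★ `DefinedExpStarBody` along a `ℚ`-isogeny pair -/

section Transport

/-- The `ℚ`-action on `ℚ_p ⊗_ℚ K` is multiplication by `q ⊗ 1`. [folklore] -/
private theorem rat_smul_eq_tmul_one_mul {p : ℕ} [Fact p.Prime] {K : Type*} [Field K] [Algebra ℚ K]
    (q : ℚ) (t : ℚ_[p] ⊗[ℚ] K) : q • t = ((q : ℚ_[p]) ⊗ₜ[ℚ] (1 : K)) * t := by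
  induction t using TensorProduct.induction_on with
  | zero => rw [smul_zero, mul_zero]
  | tmul s x => rw [TensorProduct.smul_tmul', Algebra.TensorProduct.tmul_mul_tmul, one_mul, Rat.smul_def]
  | add x y hx hy => rw [smul_add, mul_add, hx, hy]

set_option backward.isDefEq.respectTransparency false in
set_option maxHeartbeats 40000000 in
/-- ★★ **`DefinedExpStarBody` IS TRANSPORTED ALONG A `ℚ`-ISOGENY PAIR.**  Let `β : W → W₂`, `α : W₂ → W` be `ℚ`-isogenies of elliptic curves
with `α ∘ β = [e]`, `e ≠ 0`, and let `DefinedExpStarBody W p f d ι κK Λ` hold.  Then for the generator `d₂ := e • (V_pα)⁻¹ d` of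
`D⁰_dR(V_pW₂|_{Γ_{ℚ_v}})` (`e` read in `ℚ_v` through Mathlib's `ℚ_p ≃ ℚ_v`): (i) `exp*_{d₂}(η) = e⁻¹ · exp*_d(η′)` whenever `η′ = T_pα ∘ η` (cocycles of
`T_pW₂|_{Γ_{ℚ_v}}`, `T_pW|_{Γ_{ℚ_v}}`), and (ii) `DefinedExpStarBody W₂ p f d₂ ι κK (e⁻¹ • Λ ∘ α_*)` — the value maps of `ZetaBody.isogeny_transport`.
(RES)/(DEF) by `expStarCoord_map_symm` / `dualExpCoord_map_equiv` at the tower generator `e • (V_pα)⁻¹ d_{w₀}`, the cocycles pushed by `T_pα`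
(`contOneCocycles.pushAddHom`; `isogenyMapH1_oneCocycleClass`, `isogenyMapH1_conjMap`), `FilZeroLine.dualExpCoord_smul`, the displayed property of
`Ψ` read on `e⁻¹ ⊗ 1`, and `σ_{w₀→w}(e⁻¹ · X) = e⁻¹ · σ(X)` (`galAdicCompletionMap_algebraMap_adicCompletion`); the `ZetaBody` half by
`ZetaBody.isogeny_transport` with `(β_* z, x)`.
[cite: Kato2004Asterisque, §9.4 (p. 188), Thm. 9.7 (p. 189), (8.1.3) (p. 180), Ex. 13.3 (pp. 224–225)] [cite: Kato1993LNM1553, Ch. II §1.2.4 and Ex. 1.3.5]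
[cite: CasselsFrohlichANT1967, Ch. II §10 Theorem (10.2) and Ch. VII §1.1] [cite: SilvermanAEC2009, Thm. III.6.1 (a) and III.7.4] -/
theorem definedExpStarBody_isogeny_transport (W W₂ : WeierstrassCurve ℚ) [W.IsElliptic] [W₂.IsElliptic] (p : ℕ) [Fact p.Prime]
    [ContinuousSMul ℤ_[p] (W.tateModule p)] [Module.Free ℤ_[p] (W.tateModule p)] [Module.Finite ℤ_[p] (W.tateModule p)]
    [ContinuousSMul ℤ_[p] (W₂.tateModule p)] [Module.Free ℤ_[p] (W₂.tateModule p)] [Module.Finite ℤ_[p] (W₂.tateModule p)]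
    {N : ℕ} [NeZero N] (f : CuspForm (Gamma0 N) 2) {d : _}
    (ι : (n : ℕ) → (CyclotomicField n ℚ →+* ℂ)) (κK : ℝ)
    (Λ : ∀ (k' : ℕ) (r : Finset (HeightOneSpectrum (𝓞 ℚ))),
      H1 (tateRep W p) (cycSubgroup p k' r) →ₗ[ℤ_[p]] ℚ_[p] ⊗[ℚ] CyclotomicField (cycLevel p k' r) ℚ)
    (β : Isogeny W W₂) (α : Isogeny W₂ W) {e : ℤ} (he : e ≠ 0) (hαβ : ∀ P, α (β P) = e • P)
    (h : Kato2004.DefinedExpStarBody W p f d ι κK Λ) :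
    letI : ValuativeRel (NumberField.Place.Completion (Sum.inr ((Rat.HeightOneSpectrum.primesEquiv (R := 𝓞 ℚ)).symm ⟨p, Fact.out⟩) : NumberField.Place ℚ)) :=
      inferInstanceAs (ValuativeRel (((Rat.HeightOneSpectrum.primesEquiv (R := 𝓞 ℚ)).symm ⟨p, Fact.out⟩).adicCompletion ℚ))
    letI : TopologicalSpace (NumberField.Place.Completion (Sum.inr ((Rat.HeightOneSpectrum.primesEquiv (R := 𝓞 ℚ)).symm ⟨p, Fact.out⟩) : NumberField.Place ℚ)) :=
      inferInstanceAs (TopologicalSpace (((Rat.HeightOneSpectrum.primesEquiv (R := 𝓞 ℚ)).symm ⟨p, Fact.out⟩).adicCompletion ℚ))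
    haveI : IsNonarchimedeanLocalField (NumberField.Place.Completion (Sum.inr ((Rat.HeightOneSpectrum.primesEquiv (R := 𝓞 ℚ)).symm ⟨p, Fact.out⟩) : NumberField.Place ℚ)) :=
      inferInstanceAs (IsNonarchimedeanLocalField (((Rat.HeightOneSpectrum.primesEquiv (R := 𝓞 ℚ)).symm ⟨p, Fact.out⟩).adicCompletion ℚ))
    haveI : CharZero (NumberField.Place.Completion (Sum.inr ((Rat.HeightOneSpectrum.primesEquiv (R := 𝓞 ℚ)).symm ⟨p, Fact.out⟩) : NumberField.Place ℚ)) := LocalField.charZero_adicCompletion ((Rat.HeightOneSpectrum.primesEquiv (R := 𝓞 ℚ)).symm ⟨p, Fact.out⟩)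
    letI : Algebra ℚ_[p] (NumberField.Place.Completion (Sum.inr ((Rat.HeightOneSpectrum.primesEquiv (R := 𝓞 ℚ)).symm ⟨p, Fact.out⟩) : NumberField.Place ℚ)) :=
      LocalField.adicCompletionPadicAlgebra ((Rat.HeightOneSpectrum.primesEquiv (R := 𝓞 ℚ)).symm ⟨p, Fact.out⟩) p ((natCast_mem_asIdeal_iff_eq_primesEquiv_symm _ (Fact.out : p.Prime)).mpr rfl)
    haveI : Fact (¬ IsUnit ((p : ℕ) : integerC (NumberField.Place.Completion (Sum.inr ((Rat.HeightOneSpectrum.primesEquiv (R := 𝓞 ℚ)).symm ⟨p, Fact.out⟩) : NumberField.Place ℚ)))) :=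
      ⟨not_isUnit_natCast_integerC (show valuation (NumberField.Place.Completion (Sum.inr ((Rat.HeightOneSpectrum.primesEquiv (R := 𝓞 ℚ)).symm ⟨p, Fact.out⟩) : NumberField.Place ℚ)) ((p : ℕ) : (NumberField.Place.Completion (Sum.inr ((Rat.HeightOneSpectrum.primesEquiv (R := 𝓞 ℚ)).symm ⟨p, Fact.out⟩) : NumberField.Place ℚ))) < 1 from LocalField.valuation_adicCompletion_natCast_lt_one ((Rat.HeightOneSpectrum.primesEquiv (R := 𝓞 ℚ)).symm ⟨p, Fact.out⟩) p ((natCast_mem_asIdeal_iff_eq_primesEquiv_symm _ (Fact.out : p.Prime)).mpr rfl))⟩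
    haveI := isAdicComplete_integerC_natCast (show valuation (NumberField.Place.Completion (Sum.inr ((Rat.HeightOneSpectrum.primesEquiv (R := 𝓞 ℚ)).symm ⟨p, Fact.out⟩) : NumberField.Place ℚ)) ((p : ℕ) : (NumberField.Place.Completion (Sum.inr ((Rat.HeightOneSpectrum.primesEquiv (R := 𝓞 ℚ)).symm ⟨p, Fact.out⟩) : NumberField.Place ℚ))) < 1 from LocalField.valuation_adicCompletion_natCast_lt_one ((Rat.HeightOneSpectrum.primesEquiv (R := 𝓞 ℚ)).symm ⟨p, Fact.out⟩) p ((natCast_mem_asIdeal_iff_eq_primesEquiv_symm _ (Fact.out : p.Prime)).mpr rfl))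
    -- the tree's `ℚ`-algebra structure on `ℚ_v` (the one `DefinedExpStarBody`'s restricted representations are built on) pinned as the
    -- most recent local instance (as in `AdmissibleZetaClassBody`), so that it — and not `DivisionRing.toRatAlgebra` — is synthesized
    letI : Algebra ℚ (NumberField.Place.Completion (Sum.inr ((Rat.HeightOneSpectrum.primesEquiv (R := 𝓞 ℚ)).symm ⟨p, Fact.out⟩) : NumberField.Place ℚ)) :=
      NumberField.Place.instAlgebraCompletion (Sum.inr ((Rat.HeightOneSpectrum.primesEquiv (R := 𝓞 ℚ)).symm ⟨p, Fact.out⟩) : NumberField.Place ℚ)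
    letI ρT := restrictedTateRep W (NumberField.Place.Completion (Sum.inr ((Rat.HeightOneSpectrum.primesEquiv (R := 𝓞 ℚ)).symm ⟨p, Fact.out⟩) : NumberField.Place ℚ)) p
    letI ρT₂ := restrictedTateRep W₂ (NumberField.Place.Completion (Sum.inr ((Rat.HeightOneSpectrum.primesEquiv (R := 𝓞 ℚ)).symm ⟨p, Fact.out⟩) : NumberField.Place ℚ)) p
    ∃ d₂, (∀ (η : contOneCocycles ρT₂.toTopRep) (η' : contOneCocycles ρT.toTopRep),
        (∀ σ, η'.1 σ = TateModule.map p α.toAddMonoidHom (η.1 σ)) →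
        expStarCoord W₂ (show valuation (NumberField.Place.Completion (Sum.inr ((Rat.HeightOneSpectrum.primesEquiv (R := 𝓞 ℚ)).symm ⟨p, Fact.out⟩) : NumberField.Place ℚ)) ((p : ℕ) : (NumberField.Place.Completion (Sum.inr ((Rat.HeightOneSpectrum.primesEquiv (R := 𝓞 ℚ)).symm ⟨p, Fact.out⟩) : NumberField.Place ℚ))) < 1 from LocalField.valuation_adicCompletion_natCast_lt_one ((Rat.HeightOneSpectrum.primesEquiv (R := 𝓞 ℚ)).symm ⟨p, Fact.out⟩) p ((natCast_mem_asIdeal_iff_eq_primesEquiv_symm _ (Fact.out : p.Prime)).mpr rfl)) d₂ η =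
          (show (NumberField.Place.Completion (Sum.inr ((Rat.HeightOneSpectrum.primesEquiv (R := 𝓞 ℚ)).symm ⟨p, Fact.out⟩) : NumberField.Place ℚ)) from (Padic.adicCompletionEquiv (𝓞 ℚ) ⟨p, Fact.out⟩ (e : ℚ_[p])))⁻¹ * expStarCoord W (show valuation (NumberField.Place.Completion (Sum.inr ((Rat.HeightOneSpectrum.primesEquiv (R := 𝓞 ℚ)).symm ⟨p, Fact.out⟩) : NumberField.Place ℚ)) ((p : ℕ) : (NumberField.Place.Completion (Sum.inr ((Rat.HeightOneSpectrum.primesEquiv (R := 𝓞 ℚ)).symm ⟨p, Fact.out⟩) : NumberField.Place ℚ))) < 1 from LocalField.valuation_adicCompletion_natCast_lt_one ((Rat.HeightOneSpectrum.primesEquiv (R := 𝓞 ℚ)).symm ⟨p, Fact.out⟩) p ((natCast_mem_asIdeal_iff_eq_primesEquiv_symm _ (Fact.out : p.Prime)).mpr rfl)) d η') ∧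
      Kato2004.DefinedExpStarBody W₂ p f d₂ ι κK
        (fun k r => ((e : ℚ)⁻¹) • ((Λ k r).comp (isogenyMapH1 p α (cycSubgroup p k r)))) := by
  obtain ⟨hdef, hz⟩ := h
  -- the local-field structures of `ℚ_v` (the statement's `letI` chain, re-established for the terms built below)
  letI : ValuativeRel (NumberField.Place.Completion (Sum.inr ((Rat.HeightOneSpectrum.primesEquiv (R := 𝓞 ℚ)).symm ⟨p, Fact.out⟩) : NumberField.Place ℚ)) :=
    inferInstanceAs (ValuativeRel (((Rat.HeightOneSpectrum.primesEquiv (R := 𝓞 ℚ)).symm ⟨p, Fact.out⟩).adicCompletion ℚ))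
  letI : TopologicalSpace (NumberField.Place.Completion (Sum.inr ((Rat.HeightOneSpectrum.primesEquiv (R := 𝓞 ℚ)).symm ⟨p, Fact.out⟩) : NumberField.Place ℚ)) :=
    inferInstanceAs (TopologicalSpace (((Rat.HeightOneSpectrum.primesEquiv (R := 𝓞 ℚ)).symm ⟨p, Fact.out⟩).adicCompletion ℚ))
  haveI : IsNonarchimedeanLocalField (NumberField.Place.Completion (Sum.inr ((Rat.HeightOneSpectrum.primesEquiv (R := 𝓞 ℚ)).symm ⟨p, Fact.out⟩) : NumberField.Place ℚ)) :=
    inferInstanceAs (IsNonarchimedeanLocalField (((Rat.HeightOneSpectrum.primesEquiv (R := 𝓞 ℚ)).symm ⟨p, Fact.out⟩).adicCompletion ℚ))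
  haveI : CharZero (NumberField.Place.Completion (Sum.inr ((Rat.HeightOneSpectrum.primesEquiv (R := 𝓞 ℚ)).symm ⟨p, Fact.out⟩) : NumberField.Place ℚ)) := LocalField.charZero_adicCompletion ((Rat.HeightOneSpectrum.primesEquiv (R := 𝓞 ℚ)).symm ⟨p, Fact.out⟩)
  letI : Algebra ℚ_[p] (NumberField.Place.Completion (Sum.inr ((Rat.HeightOneSpectrum.primesEquiv (R := 𝓞 ℚ)).symm ⟨p, Fact.out⟩) : NumberField.Place ℚ)) :=
    LocalField.adicCompletionPadicAlgebra ((Rat.HeightOneSpectrum.primesEquiv (R := 𝓞 ℚ)).symm ⟨p, Fact.out⟩) p ((natCast_mem_asIdeal_iff_eq_primesEquiv_symm _ (Fact.out : p.Prime)).mpr rfl)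
  haveI : Fact (¬ IsUnit ((p : ℕ) : integerC (NumberField.Place.Completion (Sum.inr ((Rat.HeightOneSpectrum.primesEquiv (R := 𝓞 ℚ)).symm ⟨p, Fact.out⟩) : NumberField.Place ℚ)))) :=
    ⟨not_isUnit_natCast_integerC (show valuation (NumberField.Place.Completion (Sum.inr ((Rat.HeightOneSpectrum.primesEquiv (R := 𝓞 ℚ)).symm ⟨p, Fact.out⟩) : NumberField.Place ℚ)) ((p : ℕ) : (NumberField.Place.Completion (Sum.inr ((Rat.HeightOneSpectrum.primesEquiv (R := 𝓞 ℚ)).symm ⟨p, Fact.out⟩) : NumberField.Place ℚ))) < 1 from LocalField.valuation_adicCompletion_natCast_lt_one ((Rat.HeightOneSpectrum.primesEquiv (R := 𝓞 ℚ)).symm ⟨p, Fact.out⟩) p ((natCast_mem_asIdeal_iff_eq_primesEquiv_symm _ (Fact.out : p.Prime)).mpr rfl))⟩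
  haveI := isAdicComplete_integerC_natCast (show valuation (NumberField.Place.Completion (Sum.inr ((Rat.HeightOneSpectrum.primesEquiv (R := 𝓞 ℚ)).symm ⟨p, Fact.out⟩) : NumberField.Place ℚ)) ((p : ℕ) : (NumberField.Place.Completion (Sum.inr ((Rat.HeightOneSpectrum.primesEquiv (R := 𝓞 ℚ)).symm ⟨p, Fact.out⟩) : NumberField.Place ℚ))) < 1 from LocalField.valuation_adicCompletion_natCast_lt_one ((Rat.HeightOneSpectrum.primesEquiv (R := 𝓞 ℚ)).symm ⟨p, Fact.out⟩) p ((natCast_mem_asIdeal_iff_eq_primesEquiv_symm _ (Fact.out : p.Prime)).mpr rfl))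
  letI : Algebra ℚ (NumberField.Place.Completion (Sum.inr ((Rat.HeightOneSpectrum.primesEquiv (R := 𝓞 ℚ)).symm ⟨p, Fact.out⟩) : NumberField.Place ℚ)) :=
    NumberField.Place.instAlgebraCompletion (Sum.inr ((Rat.HeightOneSpectrum.primesEquiv (R := 𝓞 ℚ)).symm ⟨p, Fact.out⟩) : NumberField.Place ℚ)
  have hp0 : ((p : ℕ) : ℚ) ≠ 0 := by exact_mod_cast (Fact.out : p.Prime).ne_zero
  -- `e` read in `ℚ_v` (through Mathlib's `ℚ_p ≃ ℚ_v`) is non-zero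
  have hep : ((e : ℤ) : ℚ_[p]) ≠ 0 := Int.cast_ne_zero.mpr he
  have hcV : (show (NumberField.Place.Completion (Sum.inr ((Rat.HeightOneSpectrum.primesEquiv (R := 𝓞 ℚ)).symm ⟨p, Fact.out⟩) : NumberField.Place ℚ)) from (Padic.adicCompletionEquiv (𝓞 ℚ) ⟨p, Fact.out⟩ (e : ℚ_[p]))) ≠ 0 :=
    (_root_.map_ne_zero (Padic.adicCompletionEquiv (𝓞 ℚ) ⟨p, Fact.out⟩)).mpr hep
  -- push-forward of cocycles by `T_pα` at level `ℚ_v`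
  let pushV : contOneCocycles (restrictedTateRep W₂ (NumberField.Place.Completion (Sum.inr ((Rat.HeightOneSpectrum.primesEquiv (R := 𝓞 ℚ)).symm ⟨p, Fact.out⟩) : NumberField.Place ℚ)) p).toTopRep →+ contOneCocycles (restrictedTateRep W (NumberField.Place.Completion (Sum.inr ((Rat.HeightOneSpectrum.primesEquiv (R := 𝓞 ℚ)).symm ⟨p, Fact.out⟩) : NumberField.Place ℚ)) p).toTopRep :=
    contOneCocycles.pushAddHom (TateModule.map p α.toAddMonoidHom).toAddMonoidHom (continuous_tateModule_map p α.toAddMonoidHom)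
      (fun σ x => Literature.AlgebraicGeometry.Motives.tateModule_map_smul p α _ x)
  have hpushV : ∀ η σ, (pushV η).1 σ = TateModule.map p α.toAddMonoidHom (η.1 σ) := fun _ _ => rfl
  refine ⟨(d.map (LinearEquiv.ofBijective _ (rationalTateModuleMap_bijective p hp0 α)).symm (rationalTateModuleEquiv_symm_restrict p hp0 α (absGaloisRestrict ℚ (NumberField.Place.Completion (Sum.inr ((Rat.HeightOneSpectrum.primesEquiv (R := 𝓞 ℚ)).symm ⟨p, Fact.out⟩) : NumberField.Place ℚ))))).smul _ hcV, ?_, ?_⟩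
  · -- (i) the scalar dual exponential at level `ℚ_v`
    intro η η' hη
    rw [expStarCoord_smul_generator, expStarCoord_map_symm p (show valuation (NumberField.Place.Completion (Sum.inr ((Rat.HeightOneSpectrum.primesEquiv (R := 𝓞 ℚ)).symm ⟨p, Fact.out⟩) : NumberField.Place ℚ)) ((p : ℕ) : (NumberField.Place.Completion (Sum.inr ((Rat.HeightOneSpectrum.primesEquiv (R := 𝓞 ℚ)).symm ⟨p, Fact.out⟩) : NumberField.Place ℚ))) < 1 from LocalField.valuation_adicCompletion_natCast_lt_one ((Rat.HeightOneSpectrum.primesEquiv (R := 𝓞 ℚ)).symm ⟨p, Fact.out⟩) p ((natCast_mem_asIdeal_iff_eq_primesEquiv_symm _ (Fact.out : p.Prime)).mpr rfl)) hp0 α d η η' hη]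
  refine ⟨?_, ?_⟩
  · -- (RES) ∧ (DEF) at every semi-local level
    intro k r Ψ hΨ
    obtain ⟨w₀, g, hg, hrest⟩ := hdef k r Ψ hΨ
    refine ⟨w₀, g, hg, ?_⟩
    intro hw₀ _ _ _ hL
    obtain ⟨dw, hRES, hDEF⟩ := hrest hw₀ hL
    letI := LocalField.adicCompletionPadicAlgebra w₀.1 p hw₀
    have hcL : algebraMap (((Rat.HeightOneSpectrum.primesEquiv (R := 𝓞 ℚ)).symm ⟨p, Fact.out⟩).adicCompletion ℚ) (w₀.1.adicCompletion (CyclotomicField (cycLevel p k r) ℚ)) (Padic.adicCompletionEquiv (𝓞 ℚ) ⟨p, Fact.out⟩ (e : ℚ_[p])) ≠ 0 :=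
      (_root_.map_ne_zero _).mpr hcV
    -- push-forward of cocycles by `T_pα` at the tower level
    let pushT : contOneCocycles ((restrictedTateRep W₂ (NumberField.Place.Completion (Sum.inr ((Rat.HeightOneSpectrum.primesEquiv (R := 𝓞 ℚ)).symm ⟨p, Fact.out⟩) : NumberField.Place ℚ)) p).restrict
        (absGaloisRestrict (((Rat.HeightOneSpectrum.primesEquiv (R := 𝓞 ℚ)).symm ⟨p, Fact.out⟩).adicCompletion ℚ) (w₀.1.adicCompletion (CyclotomicField (cycLevel p k r) ℚ)))).toTopRep →+
        contOneCocycles ((restrictedTateRep W (NumberField.Place.Completion (Sum.inr ((Rat.HeightOneSpectrum.primesEquiv (R := 𝓞 ℚ)).symm ⟨p, Fact.out⟩) : NumberField.Place ℚ)) p).restrict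
        (absGaloisRestrict (((Rat.HeightOneSpectrum.primesEquiv (R := 𝓞 ℚ)).symm ⟨p, Fact.out⟩).adicCompletion ℚ) (w₀.1.adicCompletion (CyclotomicField (cycLevel p k r) ℚ)))).toTopRep :=
      contOneCocycles.pushAddHom (TateModule.map p α.toAddMonoidHom).toAddMonoidHom (continuous_tateModule_map p α.toAddMonoidHom)
        (fun σ x => Literature.AlgebraicGeometry.Motives.tateModule_map_smul p α _ x)
    have hpushT : ∀ η σ, (pushT η).1 σ = TateModule.map p α.toAddMonoidHom (η.1 σ) := fun _ _ => rfl
    refine ⟨(dw.map (LinearEquiv.ofBijective _ (rationalTateModuleMap_bijective p hp0 α)).symm (rationalTateModuleEquiv_symm_restrict p hp0 α _)).smul _ hcL, ?_, ?_⟩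
    · -- (RES) at `W₂`
      intro η₀ η hη
      have hW := hRES (pushV η₀) (pushT η) (fun σ => by rw [hpushT, hpushV, hη σ])
      have hfun : (fun σ => TateModule.toRational p (η.1 σ)) =
          fun σ => (LinearEquiv.ofBijective _ (rationalTateModuleMap_bijective p hp0 α)).symm ((fun σ => TateModule.toRational p ((pushT η).1 σ)) σ) := by
        funext σ
        exact ((LinearEquiv.ofBijective _ (rationalTateModuleMap_bijective p hp0 α)).symm_apply_apply (TateModule.toRational p (η.1 σ))).symm
      rw [FilZeroLine.smul_ω, FilZeroLine.dualExpCoord_smul _ hcL, hfun, FilZeroLine.dualExpCoord_map_equiv dw _ _, hW,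
        expStarCoord_smul_generator, expStarCoord_map_symm p (show valuation (NumberField.Place.Completion (Sum.inr ((Rat.HeightOneSpectrum.primesEquiv (R := 𝓞 ℚ)).symm ⟨p, Fact.out⟩) : NumberField.Place ℚ)) ((p : ℕ) : (NumberField.Place.Completion (Sum.inr ((Rat.HeightOneSpectrum.primesEquiv (R := 𝓞 ℚ)).symm ⟨p, Fact.out⟩) : NumberField.Place ℚ))) < 1 from LocalField.valuation_adicCompletion_natCast_lt_one ((Rat.HeightOneSpectrum.primesEquiv (R := 𝓞 ℚ)).symm ⟨p, Fact.out⟩) p ((natCast_mem_asIdeal_iff_eq_primesEquiv_symm _ (Fact.out : p.Prime)).mpr rfl)) hp0 α d η₀ (pushV η₀) (fun σ => rfl),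
        map_mul (algebraMap (((Rat.HeightOneSpectrum.primesEquiv (R := 𝓞 ℚ)).symm ⟨p, Fact.out⟩).adicCompletion ℚ) (w₀.1.adicCompletion (CyclotomicField (cycLevel p k r) ℚ))), map_inv₀ (algebraMap (((Rat.HeightOneSpectrum.primesEquiv (R := 𝓞 ℚ)).symm ⟨p, Fact.out⟩).adicCompletion ℚ) (w₀.1.adicCompletion (CyclotomicField (cycLevel p k r) ℚ)))]
    · -- (DEF) at `W₂`
      intro w y φ'' ψT hφ hψ
      -- the class representative `α ∘ φ″` of `g_w · α_* y`
      let φW : contOneCocycles (subgroupRep (tateRep W p).toTopRep (cycSubgroup p k r)) :=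
        contOneCocycles.pushAddHom (X := subgroupRep (tateRep W₂ p).toTopRep (cycSubgroup p k r))
          (Y := subgroupRep (tateRep W p).toTopRep (cycSubgroup p k r)) (TateModule.map p α.toAddMonoidHom).toAddMonoidHom
          (continuous_tateModule_map p α.toAddMonoidHom)
          (fun g x => Literature.AlgebraicGeometry.Motives.tateModule_map_smul p α (g : absoluteGaloisGroup ℚ) x) φ''
      have hφW_apply : ∀ g, φW.1 g = TateModule.map p α.toAddMonoidHom (φ''.1 g) := fun _ => rfl
      have hφW : oneCocycleClass _ φW =
          conjMap (tateRep W p).toTopRep (cycSubgroup p k r) (g w) 1 (isogenyMapH1 p α (cycSubgroup p k r) y) := by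
        rw [← isogenyMapH1_conjMap, ← hφ, isogenyMapH1_oneCocycleClass]
      have hW := hDEF w (isogenyMapH1 p α (cycSubgroup p k r) y) φW (pushT ψT) hφW (fun σ => by
        rw [hpushT, hφW_apply, hψ σ])
      have hfun : (fun σ => TateModule.toRational p (ψT.1 σ)) =
          fun σ => (LinearEquiv.ofBijective _ (rationalTateModuleMap_bijective p hp0 α)).symm ((fun σ => TateModule.toRational p ((pushT ψT).1 σ)) σ) := by
        funext σ
        exact ((LinearEquiv.ofBijective _ (rationalTateModuleMap_bijective p hp0 α)).symm_apply_apply (TateModule.toRational p (ψT.1 σ))).symm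
      -- left: `Ψ(e⁻¹ • Λ(α_* y))_w = e⁻¹ · Ψ(Λ(α_* y))_w`
      have hleft : Ψ ((((e : ℚ)⁻¹) • ((Λ k r).comp (isogenyMapH1 p α (cycSubgroup p k r)))) y) w =
          (algebraMap (((Rat.HeightOneSpectrum.primesEquiv (R := 𝓞 ℚ)).symm ⟨p, Fact.out⟩).adicCompletion ℚ) (w.1.adicCompletion (CyclotomicField (cycLevel p k r) ℚ)) (Padic.adicCompletionEquiv (𝓞 ℚ) ⟨p, Fact.out⟩ (e : ℚ_[p])))⁻¹ * Ψ (Λ k r (isogenyMapH1 p α (cycSubgroup p k r) y)) w := by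
        rw [LinearMap.smul_apply, LinearMap.comp_apply, rat_smul_eq_tmul_one_mul, map_mul Ψ, Pi.mul_apply, hΨ,
          map_one (algebraMap (CyclotomicField (cycLevel p k r) ℚ) (w.1.adicCompletion (CyclotomicField (cycLevel p k r) ℚ))), one_mul, Rat.cast_inv, Rat.cast_intCast,
          map_inv₀ (Padic.adicCompletionEquiv (𝓞 ℚ) ⟨p, Fact.out⟩), map_inv₀ (algebraMap (((Rat.HeightOneSpectrum.primesEquiv (R := 𝓞 ℚ)).symm ⟨p, Fact.out⟩).adicCompletion ℚ) (w.1.adicCompletion (CyclotomicField (cycLevel p k r) ℚ)))]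
      dsimp only
      rw [hleft, hW, FilZeroLine.smul_ω, FilZeroLine.dualExpCoord_smul _ hcL, hfun, FilZeroLine.dualExpCoord_map_equiv dw _ _,
        map_mul (galAdicCompletionMap (sigma (cycLevel p k r) (modNCyclotomicCharacter ℚ (cycLevel p k r) (g w)))⁻¹ (inv_smul_eq_of_smul_eq (hg w))),
        map_inv₀ (galAdicCompletionMap (sigma (cycLevel p k r) (modNCyclotomicCharacter ℚ (cycLevel p k r) (g w)))⁻¹ (inv_smul_eq_of_smul_eq (hg w))),
        galAdicCompletionMap_algebraMap_adicCompletion ((Rat.HeightOneSpectrum.primesEquiv (R := 𝓞 ℚ)).symm ⟨p, Fact.out⟩) _ w₀ w (inv_smul_eq_of_smul_eq (hg w))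
          (Padic.adicCompletionEquiv (𝓞 ℚ) ⟨p, Fact.out⟩ (e : ℚ_[p]))]
  · -- the `ZetaBody` half, witnesses `(β_* z, x)`
    intro c d' a A hA hc hd
    obtain ⟨z, x, hzx⟩ := hz c d' a A hA hc hd
    exact ⟨_, x, ZetaBody.isogeny_transport p f ι κK Λ c d' a A z x β α he hαβ hzx⟩

end Transport

end Literature.NumberTheory.EllipticCurves.Kato2004

end
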